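import Summits.CriticalPhenomena.PercolationContinuityZ3.Theorems.PercNearOneGluingNoHeavyLowerTailOneLayerForcedExpansion
import Summits.CriticalPhenomena.PercolationContinuityZ3.Theorems.PercNearOneGluingNoHeavyLowerTailKNGoodHubStar
import HarnessLib

/-!
# `NoHeavyLowerTail` (stmt-CriticalPhenomena-4575) — Kozma–Nitzan's inequality (41) and the goodness face at a one-layer
# observer from a SINGLE comparison row (any core, any number of ports); the bare-witness kernel

Support file (lemma factory `prim-lf-2` gen 9; `--supports stmt-CriticalPhenomena-4575`).  No definitions, no named facts,
no sorries.  Memo: `run/shared/lean/prim/prim-lf-2/KERNEL-PENDANT-gen9.md` (THEOREM B).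

Setting.  `o` is a one-layer observer with port set `P` (`W s(o,u) = 0` for `u ∉ P`, `u ≠ o`, and for the loop); `σ_B = starEvent o B`
are its star patterns; `i ≠ o` is a comparison vertex which, in the graph with `o` deleted, is at most as reliable towards `b` as every
port (`hport`, the hypothesis of Kozma–Nitzan's Lemma 5); `ρ_i` is the reliability of `i` under the EMPTY forced star (all pairs at `o`
closed, i.e. `o` deleted).
* `obs_ge_cmp_sub`   — `μ_W(o ↔ b) ≥ μ_W(i ↔ b) − μ_W(σ_∅)·ρ_i`  (Lemma 5 pattern by pattern; the empty pattern is the only loss).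
* `obs_ge_rho`       — `μ_W(o ↔ b) ≥ (1 − μ_W(σ_∅))·ρ_i`  (every non-empty pattern term is `≥ μ(σ_B)·ρ_i` by monotonicity).
* `obs_add_null_ge_of_row` — THE SINGLE-ROW GOODNESS FACE: if `μ_W(j ↔ b) ≤ μ_W(i ↔ b)` for some `j`, then
  `μ_W(o ↔ b) + μ_W(σ_∅)·min(μ_W(j ↔ b), ρ_i) ≥ μ_W(j ↔ b)` (dichotomy `μ(j↔b) ≤ ρ_i` / `> ρ_i` on the two bounds).  For a GAIN-FREE
  witness `j` (its reliability does not feel `o`) and `i` the loneliest other relay this is exactly Kozma–Nitzan goodness / the gluing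
  inequality GC of the `prim-hp-2` line, from ONE row instead of the full split-argmin hypothesis.
* `oneLayer_preFKG_of_bareWitness_row` — THE (41) FACE: for a BARE witness `j ∉ P` (every pair at `j` other than `s(j,b)` has weight
  `0`: a hairless relay pendant at `b`), `μ_W(j ↔ b, o ↔ A) = (1 − μ_W(σ_∅))·W s(j,b)` (`witness_side_eq_of_bare`), hence one row
  `μ_W(j↔b) ≤ μ_W(i↔b)` gives `μ_W(j ↔ b, o ↔ A) ≤ μ_W(o ↔ b)` — Question 9 / (41) at `o` for the witness `j`, over an arbitrary core.
When `o` is the glued block of several pendant stars, `μ_W(i ↔ b)` dominates `i`'s reliability in the split graph (gluing is monotone),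
so the split-world row `r_j ≤ r_i` of the kernel programme implies `hrow`: for bare (pendant) witnesses the kernel needs one comparison
with any vertex that is core-below the ports (e.g. the core-weakest port), not the full split argmin, and no condition on `i`.
-/

namespace Summit.CriticalPhenomena.PercolationContinuityZ3.Theorems

open MeasureTheory Set ProbabilityTheory
open Literature.Probability.LatticeModels
open Literature.Probability.Percolation

noncomputable section
open Classical

namespace PendantWitness

variable {n : ℕ}

/-- **Observer versus comparison vertex, minus the empty pattern.**  If `i ≠ o` is at most as reliable as every port of the one-layer
observer `o` in the graph with `o` deleted, then `μ_W(o ↔ b) ≥ μ_W(i ↔ b) − μ_W(σ_∅)·ρ_i`, `ρ_i` the reliability of `i` under the empty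
forced star. [cite: KozmaNitzan2024, Lemma 5 (p. 13), proof of Thm. 4 (pp. 13–14)] -/
theorem obs_ge_cmp_sub (W : Sym2 (Fin n) → unitInterval) (P : Finset (Fin n)) (o i b : Fin n)
    (hoP : o ∉ P) (hbo : b ≠ o) (hio : i ≠ o)
    (hiso : ∀ u : Fin n, u ≠ o → u ∉ P → W s(o, u) = 0) (hloop : W s(o, o) = 0)
    (hport : ∀ t ∈ P, (prodBernoulli W).real (openConnIn ({o}ᶜ : Set (Fin n)) i b) ≤
      (prodBernoulli W).real (openConnIn ({o}ᶜ : Set (Fin n)) t b)) :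
    (prodBernoulli W).real (openConn i b) -
        (prodBernoulli W).real (starEvent o (↑(∅ : Finset (Fin n)) : Set (Fin n))) *
          (prodBernoulli (fun e : Sym2 (Fin n) => if o ∈ e then (if ∃ p ∈ (∅ : Finset (Fin n)), e = s(o, p) then 1 else 0) else W e)).real
            (openConn i b) ≤ (prodBernoulli W).real (openConn o b) := by
  set μ := prodBernoulli W with hμ
  set ρ : ℝ := (prodBernoulli (fun e : Sym2 (Fin n) =>
    if o ∈ e then (if ∃ p ∈ (∅ : Finset (Fin n)), e = s(o, p) then 1 else 0) else W e)).real (openConn i b) with hρ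
  have hexp : ∀ E : Set (BondConfig (Fin n)), μ.real E = ∑ B ∈ P.powerset, μ.real (E ∩ starEvent o (↑B : Set (Fin n))) :=
    fun E => KNPreFKG.real_eq_sum_inter_starEvent W P o hoP hiso E
  have hO0 : μ.real (openConn o b ∩ starEvent o (↑(∅ : Finset (Fin n)) : Set (Fin n))) = 0 := by
    rw [hμ, UpsetExchange.real_inter_starEvent_eq_mul_forced W o ∅ (Finset.notMem_empty o) hloop (openConn o b),
      UpsetExchange.real_forcedStar_obs_empty W o b hbo, mul_zero]
  have hI0 : μ.real (openConn i b ∩ starEvent o (↑(∅ : Finset (Fin n)) : Set (Fin n))) =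
      μ.real (starEvent o (↑(∅ : Finset (Fin n)) : Set (Fin n))) * ρ := by
    rw [hμ, UpsetExchange.real_inter_starEvent_eq_mul_forced W o ∅ (Finset.notMem_empty o) hloop (openConn i b)]
  have hL5 : ∀ B ∈ P.powerset, B ≠ ∅ →
      μ.real (openConn i b ∩ starEvent o (↑B : Set (Fin n))) ≤ μ.real (openConn o b ∩ starEvent o (↑B : Set (Fin n))) := by
    intro B hB hBne
    have hBP : B ⊆ P := Finset.mem_powerset.1 hB
    obtain ⟨t, ht⟩ := Finset.nonempty_iff_ne_empty.2 hBne
    have htP : t ∈ P := hBP ht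
    have hto : t ≠ o := fun h => hoP (h ▸ htP)
    exact KozmaNitzan2024_lemma5_fintype W o b i t (↑B : Set (Fin n)) hio hto (Finset.mem_coe.2 ht) (hport t htP)
  have H1 := hexp (openConn o b)
  have H2 := hexp (openConn i b)
  have hObs : ∑ B ∈ P.powerset, (μ.real (openConn i b ∩ starEvent o (↑B : Set (Fin n))) -
      (if B = ∅ then μ.real (openConn i b ∩ starEvent o (↑B : Set (Fin n))) else 0)) ≤ μ.real (openConn o b) := by
    rw [H1]
    refine Finset.sum_le_sum fun B hB => ?_
    by_cases h : B = ∅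
    · subst h; rw [if_pos rfl, hO0]; linarith
    · rw [if_neg h, sub_zero]; exact hL5 B hB h
  have hite : ∑ B ∈ P.powerset, (if B = ∅ then μ.real (openConn i b ∩ starEvent o (↑B : Set (Fin n))) else 0) =
      μ.real (starEvent o (↑(∅ : Finset (Fin n)) : Set (Fin n))) * ρ := by
    rw [Finset.sum_ite_eq' P.powerset ∅ (fun B => μ.real (openConn i b ∩ starEvent o (↑B : Set (Fin n)))),
      if_pos (Finset.empty_mem_powerset P), hI0]
  rw [Finset.sum_sub_distrib, hite, ← H2] at hObs
  exact hObs

/-- **Observer versus the deleted-observer reliability of the comparison vertex.**  Under the hypotheses of `obs_ge_cmp_sub`,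
`μ_W(o ↔ b) ≥ (1 − μ_W(σ_∅))·ρ_i`. [cite: KozmaNitzan2024, Lemma 5 (p. 13), proof of Thm. 4 (pp. 13–14)] -/
theorem obs_ge_rho (W : Sym2 (Fin n) → unitInterval) (P : Finset (Fin n)) (o i b : Fin n)
    (hoP : o ∉ P) (hbo : b ≠ o) (hio : i ≠ o)
    (hiso : ∀ u : Fin n, u ≠ o → u ∉ P → W s(o, u) = 0) (hloop : W s(o, o) = 0)
    (hport : ∀ t ∈ P, (prodBernoulli W).real (openConnIn ({o}ᶜ : Set (Fin n)) i b) ≤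
      (prodBernoulli W).real (openConnIn ({o}ᶜ : Set (Fin n)) t b)) :
    (1 - (prodBernoulli W).real (starEvent o (↑(∅ : Finset (Fin n)) : Set (Fin n)))) *
        (prodBernoulli (fun e : Sym2 (Fin n) => if o ∈ e then (if ∃ p ∈ (∅ : Finset (Fin n)), e = s(o, p) then 1 else 0) else W e)).real
          (openConn i b) ≤ (prodBernoulli W).real (openConn o b) := by
  haveI : IsProbabilityMeasure (prodBernoulli W) := inferInstance
  set μ := prodBernoulli W with hμ
  set WB : Finset (Fin n) → Sym2 (Fin n) → unitInterval :=
    fun B e => if o ∈ e then (if ∃ p ∈ B, e = s(o, p) then 1 else 0) else W e with hWB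
  set ρ : ℝ := (prodBernoulli (WB ∅)).real (openConn i b) with hρ
  set π : Finset (Fin n) → ℝ := fun B => μ.real (starEvent o (↑B : Set (Fin n))) with hπ
  have hexp : ∀ E : Set (BondConfig (Fin n)), μ.real E = ∑ B ∈ P.powerset, μ.real (E ∩ starEvent o (↑B : Set (Fin n))) :=
    fun E => KNPreFKG.real_eq_sum_inter_starEvent W P o hoP hiso E
  have hπnn : ∀ B, 0 ≤ π B := fun B => measureReal_nonneg
  have hsumπ : ∑ B ∈ P.powerset, π B = 1 := by
    have h := hexp Set.univ
    simp only [Set.univ_inter, probReal_univ] at h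
    exact h.symm
  have hO0 : μ.real (openConn o b ∩ starEvent o (↑(∅ : Finset (Fin n)) : Set (Fin n))) = 0 := by
    rw [hμ, UpsetExchange.real_inter_starEvent_eq_mul_forced W o ∅ (Finset.notMem_empty o) hloop (openConn o b),
      UpsetExchange.real_forcedStar_obs_empty W o b hbo, mul_zero]
  have hIB : ∀ B ∈ P.powerset, π B * ρ ≤ μ.real (openConn i b ∩ starEvent o (↑B : Set (Fin n))) := by
    intro B hB
    have hBP : B ⊆ P := Finset.mem_powerset.1 hB
    have hoB : o ∉ B := fun h => hoP (hBP h)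
    rw [hμ, UpsetExchange.real_inter_starEvent_eq_mul_forced W o B hoB hloop (openConn i b)]
    refine mul_le_mul_of_nonneg_left ?_ (hπnn B)
    refine prodBernoulli_real_mono_of_isUpperSet ?_ (isUpperSet_openConn i b) MeasurableSet.of_discrete
    intro e
    by_cases hoe : o ∈ e
    · have h0 : WB ∅ e = 0 := by
        simp only [hWB, hoe, if_true, Finset.notMem_empty, false_and, exists_false, if_false]
      rw [h0]; exact bot_le
    · simp only [hWB, hoe, if_false]; exact le_rfl
  have hL5 : ∀ B ∈ P.powerset, B ≠ ∅ →
      μ.real (openConn i b ∩ starEvent o (↑B : Set (Fin n))) ≤ μ.real (openConn o b ∩ starEvent o (↑B : Set (Fin n))) := by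
    intro B hB hBne
    have hBP : B ⊆ P := Finset.mem_powerset.1 hB
    obtain ⟨t, ht⟩ := Finset.nonempty_iff_ne_empty.2 hBne
    have htP : t ∈ P := hBP ht
    have hto : t ≠ o := fun h => hoP (h ▸ htP)
    exact KozmaNitzan2024_lemma5_fintype W o b i t (↑B : Set (Fin n)) hio hto (Finset.mem_coe.2 ht) (hport t htP)
  have H1 := hexp (openConn o b)
  have h : ∑ B ∈ P.powerset, (π B * ρ - if B = ∅ then π B * ρ else 0) ≤ μ.real (openConn o b) := by
    rw [H1]
    refine Finset.sum_le_sum fun B hB => ?_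
    by_cases hB0 : B = ∅
    · subst hB0; rw [if_pos rfl, hO0]; linarith
    · rw [if_neg hB0, sub_zero]; exact (hIB B hB).trans (hL5 B hB hB0)
  have hite : ∑ B ∈ P.powerset, (if B = ∅ then π B * ρ else 0) = π ∅ * ρ := by
    rw [Finset.sum_ite_eq' P.powerset ∅ (fun B => π B * ρ), if_pos (Finset.empty_mem_powerset P)]
  rw [Finset.sum_sub_distrib, hite, ← Finset.sum_mul, hsumπ] at h
  show (1 - π ∅) * ρ ≤ μ.real (openConn o b)
  linarith

/-- **The single-row goodness face.**  Let `o` be a one-layer observer with port set `P`, `i ≠ o` a vertex that is at most as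
reliable as every port in the graph with `o` deleted, and `j` ANY vertex with `μ_W(j ↔ b) ≤ μ_W(i ↔ b)` (one comparison row).  Then
`μ_W(j ↔ b) ≤ μ_W(o ↔ b) + μ_W(σ_∅)·min(μ_W(j ↔ b), ρ_i)`.  For a gain-free witness `j` and `i` the loneliest other relay the
right-hand correction is Kozma–Nitzan's goodness term of `o`, so this is the gluing inequality GC from one row.
[cite: KozmaNitzan2024, Definition p. 12, Lemma 5 (p. 13), Thm. 4 (pp. 13–14)] -/
theorem obs_add_null_ge_of_row (W : Sym2 (Fin n) → unitInterval) (P : Finset (Fin n)) (o j i b : Fin n)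
    (hoP : o ∉ P) (hbo : b ≠ o) (hio : i ≠ o)
    (hiso : ∀ u : Fin n, u ≠ o → u ∉ P → W s(o, u) = 0) (hloop : W s(o, o) = 0)
    (hport : ∀ t ∈ P, (prodBernoulli W).real (openConnIn ({o}ᶜ : Set (Fin n)) i b) ≤
      (prodBernoulli W).real (openConnIn ({o}ᶜ : Set (Fin n)) t b))
    (hrow : (prodBernoulli W).real (openConn j b) ≤ (prodBernoulli W).real (openConn i b)) :
    (prodBernoulli W).real (openConn j b) ≤ (prodBernoulli W).real (openConn o b) +
      (prodBernoulli W).real (starEvent o (↑(∅ : Finset (Fin n)) : Set (Fin n))) *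
        min ((prodBernoulli W).real (openConn j b))
          ((prodBernoulli (fun e : Sym2 (Fin n) => if o ∈ e then (if ∃ p ∈ (∅ : Finset (Fin n)), e = s(o, p) then 1 else 0) else W e)).real
            (openConn i b)) := by
  haveI : IsProbabilityMeasure (prodBernoulli W) := inferInstance
  set μ := prodBernoulli W with hμ
  set ρ : ℝ := (prodBernoulli (fun e : Sym2 (Fin n) =>
    if o ∈ e then (if ∃ p ∈ (∅ : Finset (Fin n)), e = s(o, p) then 1 else 0) else W e)).real (openConn i b) with hρ
  set v : ℝ := μ.real (openConn j b) with hv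
  set π0 : ℝ := μ.real (starEvent o (↑(∅ : Finset (Fin n)) : Set (Fin n))) with hπ0
  have hπ0nn : 0 ≤ π0 := measureReal_nonneg
  have hπ0le : π0 ≤ 1 := measureReal_le_one
  have h1 : μ.real (openConn i b) - π0 * ρ ≤ μ.real (openConn o b) := obs_ge_cmp_sub W P o i b hoP hbo hio hiso hloop hport
  have h2 : (1 - π0) * ρ ≤ μ.real (openConn o b) := obs_ge_rho W P o i b hoP hbo hio hiso hloop hport
  by_cases hvρ : v ≤ ρ
  · rw [min_eq_left hvρ]
    have : (1 - π0) * v ≤ (1 - π0) * ρ := mul_le_mul_of_nonneg_left hvρ (by linarith)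
    nlinarith
  · have hρv : ρ ≤ v := le_of_lt (not_le.1 hvρ)
    rw [min_eq_right hρv]
    linarith

/-- **The witness side for a bare witness.**  If every pair at `j` other than `s(j,b)` has weight `0` and `j ∉ P`, `j ≠ o`, then
`μ_W(j ↔ b, o ↔ A) = (1 − μ_W(σ_∅))·W s(j,b)` for every `A ⊇ P` not containing `o`: on a non-empty star pattern the observer touches
`A` and the witness's only route is its own link. [cite: KozmaNitzan2024, proof of Thm. 4 (pp. 13–14)] -/
theorem witness_side_eq_of_bare (W : Sym2 (Fin n) → unitInterval) (A P : Finset (Fin n)) (o j b : Fin n)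
    (hoA : o ∉ A) (hPA : P ⊆ A) (hbo : b ≠ o) (hjo : j ≠ o) (hjb : j ≠ b) (hjP : j ∉ P)
    (hiso : ∀ u : Fin n, u ≠ o → u ∉ P → W s(o, u) = 0) (hloop : W s(o, o) = 0)
    (hbare : ∀ z : Fin n, z ≠ j → z ≠ b → W s(j, z) = 0) :
    (prodBernoulli W).real (openConn j b ∩ ⋃ a ∈ A, openConn o a) =
      (1 - (prodBernoulli W).real (starEvent o (↑(∅ : Finset (Fin n)) : Set (Fin n)))) * (W s(j, b) : ℝ) := by
  haveI : IsProbabilityMeasure (prodBernoulli W) := inferInstance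
  set μ := prodBernoulli W with hμ
  have hoP : o ∉ P := fun h => hoA (hPA h)
  set WB : Finset (Fin n) → Sym2 (Fin n) → unitInterval :=
    fun B e => if o ∈ e then (if ∃ p ∈ B, e = s(o, p) then 1 else 0) else W e with hWB
  set v : ℝ := (W s(j, b) : ℝ) with hv
  set π : Finset (Fin n) → ℝ := fun B => μ.real (starEvent o (↑B : Set (Fin n))) with hπ
  have hexp : ∀ E : Set (BondConfig (Fin n)), μ.real E = ∑ B ∈ P.powerset, μ.real (E ∩ starEvent o (↑B : Set (Fin n))) :=
    fun E => KNPreFKG.real_eq_sum_inter_starEvent W P o hoP hiso E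
  have hsumπ : ∑ B ∈ P.powerset, π B = 1 := by
    have h := hexp Set.univ
    simp only [Set.univ_inter, probReal_univ] at h
    exact h.symm
  have hWBjb : ∀ B : Finset (Fin n), WB B s(j, b) = W s(j, b) := by
    intro B
    have : ¬ o ∈ s(j, b) := by
      rw [Sym2.mem_iff, not_or]; exact ⟨hjo.symm, hbo.symm⟩
    simp only [hWB, this, if_false]
  have hbareB : ∀ B ∈ P.powerset, ∀ z : Fin n, z ≠ j → z ≠ b → WB B s(j, z) = 0 := by
    intro B hB z hzj hzb
    have hBP : B ⊆ P := Finset.mem_powerset.1 hB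
    by_cases hzo : z = o
    · subst hzo
      have hmem : z ∈ s(j, z) := Sym2.mem_mk_right j z
      have hnot : ¬ ∃ p ∈ B, s(j, z) = s(z, p) := by
        rintro ⟨p, hp, hjp⟩
        rw [Sym2.eq_iff] at hjp
        rcases hjp with ⟨hj, -⟩ | ⟨hj, -⟩
        · exact hjo hj
        · exact hjP (hBP (hj ▸ hp))
      simp only [hWB, hmem, if_true, hnot, if_false]
    · have : ¬ o ∈ s(j, z) := by
        rw [Sym2.mem_iff, not_or]; exact ⟨hjo.symm, fun h => hzo h.symm⟩
      simp only [hWB, this, if_false]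
      exact hbare z hzj hzb
  have hJ : ∀ B ∈ P.powerset, B ≠ ∅ →
      μ.real ((openConn j b ∩ ⋃ a ∈ A, openConn o a) ∩ starEvent o (↑B : Set (Fin n))) = π B * v := by
    intro B hB hBne
    have hBP : B ⊆ P := Finset.mem_powerset.1 hB
    have hoB : o ∉ B := fun h => hoP (hBP h)
    rw [UpsetExchange.real_witness_inter_starEvent W A o j b B hoB (hBP.trans hPA) (Finset.nonempty_iff_ne_empty.2 hBne) hloop]
    have hb := KNGoodHubStar.real_openConn_eq_of_bare (WB B) j b hjb (hbareB B hB)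
    rw [hWBjb B] at hb
    show π B * _ = π B * v
    congr 1
  have hJ0 : μ.real ((openConn j b ∩ ⋃ a ∈ A, openConn o a) ∩ starEvent o (↑(∅ : Finset (Fin n)) : Set (Fin n))) = 0 :=
    UpsetExchange.real_witness_inter_starEvent_empty W A o j b hoA
  have H3 := hexp (openConn j b ∩ ⋃ a ∈ A, openConn o a)
  have H3' : ∑ B ∈ P.powerset, μ.real ((openConn j b ∩ ⋃ a ∈ A, openConn o a) ∩ starEvent o (↑B : Set (Fin n))) =
      ∑ B ∈ P.powerset, (π B * v - if B = ∅ then π B * v else 0) := by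
    refine Finset.sum_congr rfl fun B hB => ?_
    by_cases h : B = ∅
    · subst h; rw [if_pos rfl, hJ0]; ring
    · rw [if_neg h, hJ B hB h]; ring
  have hite1 : ∑ B ∈ P.powerset, (if B = ∅ then π B * v else 0) = π ∅ * v := by
    rw [Finset.sum_ite_eq' P.powerset ∅ (fun B => π B * v), if_pos (Finset.empty_mem_powerset P)]
  rw [H3, H3', Finset.sum_sub_distrib, hite1, ← Finset.sum_mul, hsumπ]
  show 1 * v - π ∅ * v = (1 - π ∅) * v
  ring

/-- **(41) at a one-layer observer for a bare witness from one row** (the bare-witness kernel).  `o` one-layer with ports `P ⊆ A`,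
`o ∉ A`; `j ∉ P` bare (a hairless relay pendant at `b`); `i ≠ o` at most as reliable as every port in the graph with `o` deleted;
ONE row `μ_W(j ↔ b) ≤ μ_W(i ↔ b)`.  Then `μ_W(j ↔ b, o ↔ A) ≤ μ_W(o ↔ b)`.  Over an arbitrary weighted core; when `o` is the glued
block of pendant stars the row follows from the split-world comparison `r_j ≤ r_i` by monotonicity of gluing.
[cite: KozmaNitzan2024, Lemma 5 (p. 13), Thm. 4 (pp. 13–14), Question 9 (p. 36)] -/
theorem oneLayer_preFKG_of_bareWitness_row (W : Sym2 (Fin n) → unitInterval) (A P : Finset (Fin n)) (o j i b : Fin n)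
    (hoA : o ∉ A) (hPA : P ⊆ A) (hbo : b ≠ o) (hjo : j ≠ o) (hjb : j ≠ b) (hio : i ≠ o) (hjP : j ∉ P)
    (hiso : ∀ u : Fin n, u ≠ o → u ∉ P → W s(o, u) = 0) (hloop : W s(o, o) = 0)
    (hbare : ∀ z : Fin n, z ≠ j → z ≠ b → W s(j, z) = 0)
    (hport : ∀ t ∈ P, (prodBernoulli W).real (openConnIn ({o}ᶜ : Set (Fin n)) i b) ≤
      (prodBernoulli W).real (openConnIn ({o}ᶜ : Set (Fin n)) t b))
    (hrow : (prodBernoulli W).real (openConn j b) ≤ (prodBernoulli W).real (openConn i b)) :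
    (prodBernoulli W).real (openConn j b ∩ ⋃ a ∈ A, openConn o a) ≤ (prodBernoulli W).real (openConn o b) := by
  haveI : IsProbabilityMeasure (prodBernoulli W) := inferInstance
  have hoP : o ∉ P := fun h => hoA (hPA h)
  set μ := prodBernoulli W with hμ
  set ρ : ℝ := (prodBernoulli (fun e : Sym2 (Fin n) =>
    if o ∈ e then (if ∃ p ∈ (∅ : Finset (Fin n)), e = s(o, p) then 1 else 0) else W e)).real (openConn i b) with hρ
  set v : ℝ := (W s(j, b) : ℝ) with hv
  set π0 : ℝ := μ.real (starEvent o (↑(∅ : Finset (Fin n)) : Set (Fin n))) with hπ0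
  have hπ0nn : 0 ≤ π0 := measureReal_nonneg
  have hvj : μ.real (openConn j b) = v := KNGoodHubStar.real_openConn_eq_of_bare W j b hjb hbare
  have hW := witness_side_eq_of_bare W A P o j b hoA hPA hbo hjo hjb hjP hiso hloop hbare
  have hG := obs_add_null_ge_of_row W P o j i b hoP hbo hio hiso hloop hport hrow
  rw [hW]
  rw [← hμ, hvj] at hG
  have hmin : min v ρ ≤ v := min_le_left v ρ
  have : π0 * min v ρ ≤ π0 * v := mul_le_mul_of_nonneg_left hmin hπ0nn
  show (1 - π0) * v ≤ μ.real (openConn o b)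
  nlinarith

end PendantWitness

end

end Summit.CriticalPhenomena.PercolationContinuityZ3.Theorems
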